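import Literature.Geometry.Lorentzian.InverseMeanCurvatureFlowUniqueness
import HarnessLib

/-!
# Inverse mean curvature flow I — proofs: assembling the initial value problem (††)

Elementary steps of the last part of the proof of Huisken–Ilmanen's Weak Existence Theorem 3.1
(J. Differential Geom. 59 (2001), §3, p. 26–27) which are independent of the elliptic theory of
the regularisation (⋆)_ε:

* `isProperFun_of_forall_le_add` — **properness from a proper subsolution below**: if `v` is
  proper (`{s ≤ v ≤ t}` compact), continuous, with `{v < 0}` precompact (so `v` is bounded
  below), and `u` is continuous with `v ≤ u + c`, then `u` is proper. In loc. cit. the solution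
  `u` is obtained with `u ≥ v` ("the Compactness Theorem 2.1 yields a solution `u` defined
  everywhere on `M`, with `u ≥ v`"), and this is how its properness — needed for the uniqueness
  class of Thm. 2.2 (iii) — follows.
* `setOf_lt_eq_of_neg_of_nonneg` — `E₀ = {u < 0}` from `u < 0` on `E₀` and `u ≥ 0` off `E₀`
  ("extend `u` negatively to `E₀` so that `E₀ = {u < 0}`").
* `IsWeakSupersolution.le_of_isWeakSubsolution_of_forall_pos` — **`u ≥ w` from interior
  comparison and boundary behaviour**: if for every `δ > 0`, `{u < w − δ} ∩ Ω ⊂⊂ Ω`, then `w ≤ u`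
  on `Ω` (Thm. 2.2 (i) applied to `w − δ`). This replaces the metric surgery of step 2 of the
  printed proof (which uses Thm. 2.2 (ii) on a modified complete manifold `(U_L, g_L)`): with the
  Dirichlet data `u = L` on `∂U_L ⊇ ∂{v < L}` and `u = 0` on `∂E₀`, interior comparison on
  `U_L ∖ Ē₀` already gives `u_L ≥ min(v, L)`.

Everything is proved; there are no definitions and no named facts.

## References

* G. Huisken, T. Ilmanen, *The inverse mean curvature flow and the Riemannian Penrose
  inequality*, J. Differential Geom. 59 (2001) 353–437: §3, proof of Thm. 3.1 (end of step 1,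
  end of step 2).
-/

noncomputable section

open Bundle Set Filter Topology

namespace Literature.Geometry.Lorentzian

variable {X : Type*} [TopologicalSpace X]

/-- A proper continuous function with precompact negative set is bounded below. [folklore] -/
theorem exists_forall_le_of_isCompact_closure_setOf_lt {v : X → ℝ} (hvc : Continuous v)
    (hF : IsCompact (closure {x | v x < 0})) : ∃ m, ∀ x, m ≤ v x := by
  by_cases hne : {x | v x < 0}.Nonempty
  · obtain ⟨x₀, hx₀, hmin⟩ := hF.exists_isMinOn (hne.mono subset_closure) hvc.continuousOn
    refine ⟨min (v x₀) 0, fun x ↦ ?_⟩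
    by_cases hx : v x < 0
    · exact (min_le_left _ _).trans (hmin (subset_closure hx))
    · exact (min_le_right _ _).trans (not_lt.1 hx)
  · refine ⟨0, fun x ↦ not_lt.1 fun hx ↦ hne ⟨x, hx⟩⟩

/-- **Properness from a proper function below.** If `v` is proper in Huisken–Ilmanen's sense
(`IsProperFun`: all `{s ≤ v ≤ t}` compact), continuous, with `{v < 0}` precompact, and `u` is
continuous with `v ≤ u + c` everywhere, then `u` is proper: `{s ≤ u ≤ t}` is a closed subset of
the compact set `{m ≤ v ≤ t + c}`, `m` a lower bound of `v`. This is how the properness of the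
solution `u ≥ v` of Thm. 3.1 follows from that of the subsolution `v`
(Huisken–Ilmanen 2001, proof of Thm. 3.1, step 2: "yields a solution `u` … with `u ≥ v`").
[cite: HuiskenIlmanenIMCF2001, §3 proof of Thm. 3.1 (step 2)] -/
theorem isProperFun_of_forall_le_add {u v : X → ℝ} (hv : IsProperFun v)
    (hvc : Continuous v) (hF : IsCompact (closure {x | v x < 0})) (huc : Continuous u) {c : ℝ}
    (hle : ∀ x, v x ≤ u x + c) : IsProperFun u := by
  obtain ⟨m, hm⟩ := exists_forall_le_of_isCompact_closure_setOf_lt hvc hF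
  intro s t
  refine (hv m (t + c)).of_isClosed_subset (isClosed_Icc.preimage huc) fun x hx ↦ ?_
  simp only [mem_preimage, mem_Icc] at hx ⊢
  exact ⟨hm x, by linarith [hle x]⟩

omit [TopologicalSpace X] in
/-- `E₀ = {u < 0}` when `u < 0` on `E₀` and `u ≥ 0` off `E₀` (the normalisation "extend `u`
negatively to `E₀` so that `E₀ = {u < 0}`" at the end of step 1 of the proof of Thm. 3.1).
[cite: HuiskenIlmanenIMCF2001, §3 proof of Thm. 3.1 (end of step 1)] -/
theorem setOf_lt_eq_of_neg_of_nonneg {u : X → ℝ} {E₀ : Set X} (hneg : ∀ x ∈ E₀, u x < 0)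
    (hnonneg : ∀ x ∉ E₀, 0 ≤ u x) : E₀ = {x | u x < 0} := by
  ext x
  refine ⟨fun hx ↦ hneg x hx, fun hx ↦ by_contra fun hxE ↦ ?_⟩
  exact absurd (hnonneg x hxE) (not_le.2 hx)

section Comparison

open Manifold MeasureTheory
open scoped Manifold ContDiff

variable [ChartedSpace E3 X] [IsManifold (𝓡 3) ∞ X]
  (h : ContMDiffRiemannianMetric (𝓡 3) ∞ E3 (TangentSpace (𝓡 3) : X → Type _))
  [T2Space X] [LocallyCompactSpace X] [MeasurableSpace X] [BorelSpace X]
  [SecondCountableTopology X] [ConnectedSpace X] [NoncompactSpace X]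

/-- **Lower bounds for weak solutions from a subsolution and boundary behaviour** (the
surgery-free replacement of step 2 of Huisken–Ilmanen's proof of Thm. 3.1). Let `u` be a weak
supersolution and `w` a weak subsolution of (∗∗) on the open set `Ω` of the connected noncompact
`X`, and suppose that for every `δ > 0` the set `{x ∈ Ω | u x < w x − δ}` is contained in a compact
subset of `Ω` (i.e. `u ≥ w − δ` near `∂Ω` and at infinity in `Ω` — e.g. from Dirichlet data
`u = L ≥ w` on the outer boundary and `u = 0 ≥ w` on `∂E₀`). Then `w ≤ u` on `Ω`: apply
Thm. 2.2 (i) (`IsWeakSupersolution.le_of_isWeakSubsolution`) to the subsolutions `w − δ`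
(`IsWeakSubsolution.add_const`) and let `δ → 0`. Huisken–Ilmanen obtain the corresponding bound
`u_L ≥ v` on `F_L` from Thm. 2.2 (ii) after modifying the metric near `∂U_L` (proof of Thm. 3.1,
step 2); with interior comparison the modification is unnecessary.
[cite: HuiskenIlmanenIMCF2001, Thm. 2.2 (i) and §3 proof of Thm. 3.1 (step 2)] -/
theorem IsWeakSupersolution.le_of_isWeakSubsolution_of_forall_pos {u w : X → ℝ} {Ω : Set X}
    (hu : IsWeakSupersolution h u Ω) (hw : IsWeakSubsolution h w Ω) (hΩ : IsOpen Ω)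
    (hbdry : ∀ δ : ℝ, 0 < δ → ∃ C : Set X, IsCompact C ∧ C ⊆ Ω ∧
      {x | x ∈ Ω ∧ u x < w x - δ} ⊆ C) :
    ∀ x ∈ Ω, w x ≤ u x := by
  intro x hx
  refine le_of_forall_pos_le_add fun δ hδ ↦ ?_
  obtain ⟨C, hC, hCΩ, hsub⟩ := hbdry δ hδ
  have hwδ : IsWeakSubsolution h (fun y ↦ w y + (-δ)) Ω := hw.add_const h hΩ (-δ)
  have key := hu.le_of_isWeakSubsolution h hwδ hΩ hC hCΩ (fun y hy ↦ hsub ⟨hy.1, by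
    have := hy.2; linarith⟩)
  have := key x hx
  linarith

end Comparison

end Literature.Geometry.Lorentzian

end
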